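import Summits.Ventures.QEC.Census.BB.BB144.Cert
import Summits.Ventures.QEC.Census.BB.BB144Index
import Summits.Ventures.QEC.Theses.BB144DistanceCertificate
import HarnessLib

/-!
# Route BB144DistanceCertificate, item WeightTwelveZLogical (stmt-Ventures-19773): the gross code `BB.bb144`
# (`[[144,12,12]]` CLAIM) has a `Z`-logical of weight exactly `12`

The kernel-A certificate `cert/BB144.certA.json` (qec-search-1; emitted as `BB144.cert : DistCert` by qec-search-7,
`Census/BB/BB144/Cert.lean`) lists the upper witness `upper.witness_Z`: a weight-12 `Z`-type operator `w` with zero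
`H^X`-syndrome and a NON-MEMBERSHIP witness `u` (`H^Z u = 0`, `|u ∩ w|` odd ⇒ `w ∉ rowspace H^Z`, type-02's
`not_mem_rowSpace_of_witness`). The `Z`-side upper check of type-10's checker (`upperOK`) is evaluated by
`decide +kernel`; its soundness `upper_sound` gives the flat witness; the kernel-checked index identity
`rowMatrix 144 cert.HX = BB.bb144.HXFlat` (certificate literal = generator file `BB144Index` = typed code, type-05) and
type-05's `BB.Code.zWitness_of_flat` transport it to the typed code. Tier KERNEL (axioms standard, no
`native_decide`). This certifies `d_Z(BB.bb144) ≤ 12`; the lower bound is item NoZLogicalBelowTwelve.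
-/

namespace Summit.Ventures.QEC.Census.BB144

open Matrix Literature.InformationTheory.QuantumCodes Summit.Ventures.QEC.BB

/-- The `Z`-side upper check passes (kernel `decide`): the witness has zero `H^X`-syndrome and weight `12`, the
non-membership witness has zero `H^Z`-syndrome and odd overlap with it. -/
theorem upperZ_ok : upperOK cert.n cert.HX cert.HZ cert.sideZ.d cert.sideZ.witness cert.sideZ.nonmember = true := by
  decide +kernel

/-- The certificate's `H^X` is the generator file's `HX` (`BB144Index`), entry for entry. -/
theorem rowMatrix_HX_eq : rowMatrix cert.n cert.HX = ofSupports bb144SupportsX := by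
  ext i j
  decide +kernel +revert

/-- The certificate's `H^Z` is the generator file's `HZ`, entry for entry. -/
theorem rowMatrix_HZ_eq : rowMatrix cert.n cert.HZ = ofSupports bb144SupportsZ := by
  ext i j
  decide +kernel +revert

/-- The certificate's `H^X` IS the typed code's flat `H^X`. -/
theorem HX_eq_flat : rowMatrix cert.n cert.HX = BB.bb144.HXFlat :=
  rowMatrix_HX_eq.trans bb144_HXFlat_eq_ofSupports.symm

/-- The certificate's `H^Z` IS the typed code's flat `H^Z`. -/
theorem HZ_eq_flat : rowMatrix cert.n cert.HZ = BB.bb144.HZFlat :=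
  rowMatrix_HZ_eq.trans bb144_HZFlat_eq_ofSupports.symm

/-- Commutation of the certificate's matrices, inherited from the typed code through the index identity (no kernel
replay needed). -/
theorem comm_flat : rowMatrix cert.n cert.HX * (rowMatrix cert.n cert.HZ)ᵀ = 0 := by
  rw [HX_eq_flat, HZ_eq_flat]
  exact BB.bb144.HXFlat_mul_HZFlat_transpose

/-- **Item WeightTwelveZLogical, PROVED**: some `Z`-type logical operator of `BB.bb144` has Hamming weight exactly
`12` — the certificate's upper witness, checked in the kernel and transported to the typed code. -/
theorem weightTwelveZLogical_proof : Summit.Ventures.QEC.Theses.BB144DistanceCertificate.WeightTwelveZLogical := by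
  obtain ⟨hv, hv', hwt⟩ := upper_sound upperZ_ok
  exact BB.bb144.zWitness_of_flat (D := CSSCode.ofMatrices (rowMatrix cert.n cert.HX) (rowMatrix cert.n cert.HZ) comm_flat)
    HX_eq_flat HZ_eq_flat ⟨ofBits cert.n cert.sideZ.witness, hv, hv', hwt⟩

end Summit.Ventures.QEC.Census.BB144
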